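import Literature.MathematicalPhysics.QuantumFieldTheory.Balaban1983to89.B9Thm311SmallFieldCoercivityTower

/-!
# `Balaban1983to89.B9Thm311SmallFieldCoercivityTowerL2` — T. Bałaban, *Propagators for lattice gauge theories in a background field*, Commun.
# Math. Phys. **99** (1985) 389–434 [Balaban1985BackgroundPropagators] Thm 3.11 p. 416 with (3.82)–(3.86) p. 407, AT `k = n+1` AVERAGING LEVELS:
# **`B9Thm311SmallFieldCoercivityTower` §3–§4 WITH THE SECTIONS OF `Q′_k` READ IN THE `L²` CURRENCY** — the four displays `(S₁, S₂, CS, ρ′)`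
# (right inverses bounded by `CS` FROM THE SUP NORM, the tower letter `‖Q′_k(U)λ − Q′_k(1)λ‖_∞ ≤ ρ′‖λ‖`) replaced by `(S₁, S₂)` and ONE `L²`
# letter `ρ` — `‖S₁(Q′_k(1)λ − Q′_k(U)λ)‖_{L²(c₀)} ≤ ρ‖λ‖_{L²(c₀)}`, `‖S₂(Q′_k(U)λ − Q′_k(1)λ)‖_{L²(c₀)} ≤ ρ‖λ‖_{L²(c₀)}` — exactly as the
# assembled remainder `norm_principalGFk_sub_flat_le` (§2 there) already consumes them; NE9 leaf-02 gen 64's ASK (d)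

statement-level skeleton of published theorems with citation tags; proofs where landed; nothing here is a claim about the Yang–Mills mass gap

CITATION HEADER (lean-in-tree rule).  Audit cell `pub-balaban`, sub-cell `t4`, BINDER row NE9; filed by the row OWNER lineage `b2b-balaban-t4-ne9-p1`
(gen 85), INTENT I-ne9p1-g85-5, on NE9 leaf-02 gen 64's located audit R-ne9leaf02-g64-1 ∕ ASK (d) (journal 2026-08-22): in the host the product
`CS·ρ′ ∝ L^{kd}√#T_m` (sup→`L²` section constant × `L²`→sup letter) put the coarse VOLUME and `L^{kd}` into `ε₀`; in the `L²` currency leaf-02's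
block-constant flat section (`B9Eq319QprimeTowerFlatSection`), `ℓ²` tower letter (`B9Eq319QprimeTowerLipschitzL2`) and Neumann section of `Q′_k(U)`
(`B9Eq319QprimeTowerNeumannSection`) inhabit `(S₁, ρ)`, `(S₂, ρ∕(1−ρ))` with `ρ = M_φ′M_φ(Π_{j≤n}(1 + 2M_φM_φ′ε_j)^{d(L−1)} − 1)` — NO volume, NO
`L^{kd}`.  Sources READ by this lineage: [Balaban1985BackgroundPropagators] pp. 407, 416 (`paper:balaban1985-cmp99-background-propagators`, +388).

THE PRINT (verbatim).  p. 416: *«Theorem 3.11. Under the assumptions of the Theorems 3.1–3.10 (i.e. for M sufficiently large and α₀ sufficiently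
small) the operators Δ′_a, G′, (Q′G′²Q′*)⁻¹, Δ_a, G are positive definite.»*  p. 407, (3.84): *«Δ_a(U′U) = Δ_a(U) − V(A) = (I − V(A)G(U))Δ_a(U)»*.

WHAT IS PROVED (sorry-free; no `def`, no `Prop` placeholder; no inequality of the paper asserted).
* §1 **`exists_coercive_principalk_of_small_field_L2`** — THERE ARE `γ, ε₀ > 0` (finite-lattice numbers: the host's, with `CS := 1`) such that for
  EVERY background `U` of the tower's data with unit-bounded `ε`-small bond variables, `hRS`, right inverses `S₁` of `Q′_k(1)` and `S₂` of `Q′_k(U)`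
  with the two `L²` letters `‖S₁(Q′_k(1)λ − Q′_k(U)λ)‖ ≤ ρ‖λ‖`, `‖S₂(Q′_k(U)λ − Q′_k(1)λ)‖ ≤ ρ‖λ‖`, the `Q`-letter `‖Q_k(U)x − Q_k(1)x‖ ≤ δ_Q‖x‖`,
  and `ε + ρ + δ_Q ≤ ε₀`: `γ‖x‖² ≤ re⟨x, (D*D + DR_k(U)D* + aQ_k(U)†Q_k(U))x⟩` — the host's §3 proof VERBATIM with the two `L²` letters as
  hypotheses instead of `CS·ρ′`.
* §2 **`laplaceAk_pos_of_small_field_L2`**, **`laplaceAk_pos_of_small_field_unitary_L2`** — the host's §4 (with the curvature part) on §1.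
HONEST RIDER (the owner's DIAGNOSIS D-ne9p1-g85-1).  With the volume gone, `ε₀` is still NOT level-free: the Kato-gap `R`-remainder pits the operator
norm of `Δ^η` on the fine lattice (`≈ 4d‖η⁻¹‖² = 4dL^{2(n+1)}` on print's diagonal) against the unit-block modulus `μ = 2∕((L^{n+1}η)²) = 2`, so
`ε₀ ≲ γ(d,a)∕(10³d²L^{4(n+1)})` on the diagonal — intrinsic to this route; the level-free `R`-letter is print's Green's-function route (3.25)
(`B9Eq324DeltaPrimeATower` ff.).  MODEL ∕ DECLARED READINGS as the host (M1)–(M6); displays left: `hRS`∕unitarity, `(S₁, S₂, ρ)` in `L²`, `δ_Q`.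
HONEST SCOPE.  [folklore] re-typing of two hypotheses of a landed finite-dimensional perturbation argument; NOT summit progress (cell pub-balaban: NE9
NOT PRINTED ∕ NOT PROVED, «NE9 ⇐ the named binders»; row WALLED ON A MODEL; spine PROVED 0/9; rung (B)+1 finite T⁴ — NOT infinite volume, NOT mass
gap, NOT Clay; HONEST DEPENDENCY: continuum YM on T⁴ ⇐ BetaPertH ∧ nine spine estimates (0/9 proved); BetaPertH ⇐ (D1) ∧ (D4) ∧ CAP+tail; G-an2-4
gates asym, D1 and NE2/3/4).  NEW file importing `B9Thm311SmallFieldCoercivityTower` only; nothing modified.  Net new unproved facts: 0.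
-/

noncomputable section

open scoped InnerProductSpace ComplexConjugate BigOperators

namespace Literature.MathematicalPhysics.QuantumFieldTheory.Balaban1983to89.B9Thm311SmallFieldCoercivityTowerL2


open B4Sect5Torus (TSite)
open B9SectCLatticeCarrier (Bond)
open B7Prop1Explicit (U1 Wcx boxVec)
open B9Eq311L2Pairing (WL2)
open B9Eq33CovDerivVector (covDeriv)
open B9Eq319QprimeTorus (fineP)
open B11Eq103H1Complex (SiteL2K BondL2K covDerivL2K covDivL2K covLaplaceSiteK laplaceAK laplaceAK_apply laplaceALatticeK RLatticeK projR
  equiv_covDerivL2K inner_covDivL2K_covDerivL2K)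
open B9Eq310HessianOperator (adTransportW adTransportW_apply principalOpK covCurlL2K covCoCurlL2K)
open B9Eq315QTorus (perCfg cornerSite)
open B9Eq315QTower (towerP UlevOf)
open B9Eq315QTowerFlat (perCfg_UlevOf_one_mem_U1 norm_Wcx_UlevOf_one_sub_one_le)
open B9Eq326OperatorTower (QprimeTowerW QkW RofUk)
open B9Eq326OperatorTowerFlat (QprimeTowerW_one_const exists_coercive_principalk_one)
open B5Eq172HodgePositivity (adTransportW_one coercive_of_sub_le conj_inv_ofReal hRS_one)
open B5Eq172PoincareTorus (const_of_covDeriv_eq_zero)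
open B9Eq368ProjectionRemainder (norm_projR_sub_projR_le norm_projR_le exists_modulus_of_ker_inj)
open B9Eq373DerivativeRemainderL2 (norm_adjoint_apply_le norm_covDerivL2K_sub_le norm_covDerivL2K_le norm_covDivL2K_sub_le norm_covDivL2K_le
  norm_covLaplaceSiteK_sub_le norm_covLaplaceSiteK_le norm_principal_sub_le)
open B9Eq384RemainderLetters (norm_laplaceAK_sub_le adTransportW_one_apply adTransportW_one_inv_apply norm_adTransportW_sub_le)

variable {d : ℕ} (L : ℕ) [NeZero L] (m : Fin d → ℕ) [∀ i, NeZero (m i)] (n : ℕ) (hL : 1 ≤ L)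
  {𝔸 : Type*} [NormedRing 𝔸] [NormedAlgebra ℂ 𝔸] [CompleteSpace 𝔸] [NormOneClass 𝔸]
  {W : Type*} [NormedAddCommGroup W] [InnerProductSpace ℂ W] [FiniteDimensional ℂ W] (φ : W ≃ₗ[ℂ] 𝔸) {c₀ c₁ : ℝ} [Fact (0 < c₀)] [Fact (0 < c₁)]
open B9Thm311SmallFieldCoercivityTower (exists_flat_modulus_tower norm_principalGFk_sub_flat_le)

/-! ## §1 [B9] Thm 3.11's second half at `k` levels, the sections of `Q′_k` read in `L²`: `∃ γ ε₀ > 0` -/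

section SmallField

/-- arithmetic helper: `t ≤ μ/(2B+1)` gives `B·t ≤ μ/2`. [folklore] -/
private theorem mul_le_half_of_le_div {B μ t : ℝ} (hB : 0 ≤ B) (hμ : 0 ≤ μ) (ht : t ≤ μ / (2 * B + 1)) : B * t ≤ μ / 2 := by
  have h1 : B * t ≤ B * (μ / (2 * B + 1)) := mul_le_mul_of_nonneg_left ht hB
  have h2 : B * (μ / (2 * B + 1)) ≤ μ / 2 := by
    rw [mul_div_assoc', div_le_div_iff₀ (by positivity) (by norm_num)]
    nlinarith
  exact h1.trans h2

variable (α : ℕ → ℝ) (hα1 : ∀ j, α j ≤ 1 / 64)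

set_option maxHeartbeats 400000 in
/-- **[B9] THM 3.11, SECOND HALF, AT `k = n+1` LEVELS AND A FIXED LATTICE, THE SECTIONS OF `Q′_k` READ IN `L²`** — the host's
`exists_coercive_principalk_of_small_field` with NE9 leaf-02's ASK (d): THERE ARE `γ, ε₀ > 0` (finite-lattice numbers: the flat constant of
`B9Eq326OperatorTowerFlat.exists_coercive_principalk_one`, the flat modulus, the operator norm of `Q_k(1)`, `d`, `η`, `L`, `c₀`, `a`, `M_φ`, `M_φ′`; the
host's `CS` set to `1`) such that for EVERY background `U` of the tower's displayed data with unit-bounded `ε`-small bond variables, mutually adjoint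
transporters (`hRS`), right inverses `S₁` of `Q′_k(1)` and `S₂` of `Q′_k(U)` with the two `L²` letters `‖S₁(Q′_k(1)λ − Q′_k(U)λ)‖ ≤ ρ‖λ‖`,
`‖S₂(Q′_k(U)λ − Q′_k(1)λ)‖ ≤ ρ‖λ‖` (DISPLAYED; inhabited volume-free by `B9Eq319QprimeTowerFlatSection` + `B9Eq319QprimeTowerLipschitzL2` +
`B9Eq319QprimeTowerNeumannSection`) and `‖Q_k(U)x − Q_k(1)x‖ ≤ δ_Q‖x‖`, with `ε + ρ + δ_Q ≤ ε₀`, the coercivity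
`γ‖x‖² ≤ re⟨x, (D*D + DR_k(U)D* + aQ_k(U)†Q_k(U))x⟩` HOLDS.  Volume-free inputs admitted; `ε₀` NOT uniform in `k` (see the file's HONEST RIDER).
[cite: Balaban1985BackgroundPropagators, Thm 3.11 p.416, (3.82)–(3.86) p.407, (3.15) p.393; Balaban1984PropagatorsI, (1.72) p.30] -/
theorem exists_coercive_principalk_of_small_field_L2 {η : ℝ} (hη : η ≠ 0) {a : ℝ} (ha : 0 < a) {Mφ Mφ' : ℝ} (hMφ : 0 ≤ Mφ) (hMφ' : 0 ≤ Mφ')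
    (hφ : ∀ w, ‖φ w‖ ≤ Mφ * ‖w‖) (hφ' : ∀ X, ‖φ.symm X‖ ≤ Mφ' * ‖X‖) :
    ∃ γ ε₀ : ℝ, 0 < γ ∧ 0 < ε₀ ∧ ∀ (U : Bond d (towerP L m (n + 1)) → 𝔸ˣ)
      (hU1 : ∀ (j : ℕ) (x : B7Prop1Explicit.Site d) (κ : Fin d), perCfg (towerP L m (j + 1)) (UlevOf L m (n + 1) U j) x κ ∈ U1 𝔸)
      (hreg : ∀ (j : ℕ) (y : TSite d (towerP L m j)) (κ : Fin d) (r : Fin d → Fin L),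
        ‖((Wcx L (perCfg (towerP L m (j + 1)) (UlevOf L m (n + 1) U j)) (cornerSite L y) κ (boxVec L r) : 𝔸ˣ) : 𝔸) - 1‖ ≤ α j)
      (S₁ S₂ : (TSite d m → W) →ₗ[ℂ] SiteL2K ℂ d (towerP L m (n + 1)) c₀ W)
      {ε ρ' δQ : ℝ}, 0 ≤ ε → 0 ≤ ρ' → 0 ≤ δQ → ε + ρ' + δQ ≤ ε₀ →
      (∀ b, U b ∈ U1 𝔸) → (∀ b, ‖(U b : 𝔸) - 1‖ ≤ ε) →
      (∀ (b : Bond d (towerP L m (n + 1))) (v u : W), ⟪adTransportW φ U b v, u⟫_ℂ = ⟪v, adTransportW φ (fun b => (U b)⁻¹) b u⟫_ℂ) →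
      (∀ f, QprimeTowerW L m n φ (fun _ : Bond d (towerP L m (n + 1)) => (1 : 𝔸ˣ)) (S₁ f) = f) →
      (∀ f, QprimeTowerW L m n φ U (S₂ f) = f) →
      (∀ l : SiteL2K ℂ d (towerP L m (n + 1)) c₀ W,
        ‖S₁ (QprimeTowerW L m n φ (fun _ : Bond d (towerP L m (n + 1)) => (1 : 𝔸ˣ)) l - QprimeTowerW L m n φ U l)‖ ≤ ρ' * ‖l‖) →
      (∀ l : SiteL2K ℂ d (towerP L m (n + 1)) c₀ W,
        ‖S₂ (QprimeTowerW L m n φ U l - QprimeTowerW L m n φ (fun _ : Bond d (towerP L m (n + 1)) => (1 : 𝔸ˣ)) l)‖ ≤ ρ' * ‖l‖) →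
      (∀ x : BondL2K ℂ d (towerP L m (n + 1)) c₀ W, ‖QkW L m n φ U hL α hα1 hU1 hreg (c₁ := c₁) x -
        QkW L m n φ (fun _ : Bond d (towerP L m (n + 1)) => (1 : 𝔸ˣ)) hL (fun _ => 0) (fun _ => by norm_num)
          (perCfg_UlevOf_one_mem_U1 L m (n + 1)) (norm_Wcx_UlevOf_one_sub_one_le L m (n + 1) (fun _ => 0) (fun _ => le_rfl)) (c₁ := c₁) x‖ ≤
        δQ * ‖x‖) →
      ∀ x : BondL2K ℂ d (towerP L m (n + 1)) c₀ W, γ * ‖x‖ ^ 2 ≤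
        RCLike.re ⟪x, laplaceALatticeK ((η : ℂ))⁻¹ (adTransportW φ U) (adTransportW φ fun b => (U b)⁻¹) (principalOpK φ η U) (RofUk L m n φ η U)
          (QkW L m n φ U hL α hα1 hU1 hreg (c₁ := c₁)) a x⟫_ℂ := by
  have hc₀ : 0 < c₀ := Fact.out
  obtain ⟨CS, hCSdef⟩ : ∃ CS : ℝ, CS = 1 := ⟨_, rfl⟩
  have hCS : 0 ≤ CS := by rw [hCSdef]; norm_num
  -- the flat constants: `γ₀` (gen 83's tower Hodge package), `μ` (the host's §1), `MQ = ‖Q_k(1)‖`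
  obtain ⟨γ₀, hγ₀, hflat⟩ := exists_coercive_principalk_one L m n hL φ (c₀ := c₀) (c₁ := c₁) hη (fun _ => 0) (fun _ => by norm_num)
    (perCfg_UlevOf_one_mem_U1 L m (n + 1)) (norm_Wcx_UlevOf_one_sub_one_le L m (n + 1) (fun _ => 0) (fun _ => le_rfl)) ha
  obtain ⟨μ, hμ, hmod⟩ := exists_flat_modulus_tower L m n φ (c₀ := c₀) hη
  obtain ⟨MQ, hMQdef⟩ : ∃ MQ : ℝ, MQ = ‖LinearMap.toContinuousLinearMap
    (QkW L m n φ (fun _ : Bond d (towerP L m (n + 1)) => (1 : 𝔸ˣ)) hL (fun _ => 0) (fun _ => by norm_num)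
      (perCfg_UlevOf_one_mem_U1 L m (n + 1)) (norm_Wcx_UlevOf_one_sub_one_le L m (n + 1) (fun _ => 0) (fun _ => le_rfl)) (c₀ := c₀) (c₁ := c₁))‖ :=
    ⟨_, rfl⟩
  have hMQ : 0 ≤ MQ := by rw [hMQdef]; positivity
  have hQ₁ : ∀ x : BondL2K ℂ d (towerP L m (n + 1)) c₀ W,
      ‖QkW L m n φ (fun _ : Bond d (towerP L m (n + 1)) => (1 : 𝔸ˣ)) hL (fun _ => 0) (fun _ => by norm_num)
        (perCfg_UlevOf_one_mem_U1 L m (n + 1)) (norm_Wcx_UlevOf_one_sub_one_le L m (n + 1) (fun _ => 0) (fun _ => le_rfl)) (c₀ := c₀) (c₁ := c₁) x‖ ≤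
      MQ * ‖x‖ := fun x => by
    rw [hMQdef]
    exact (LinearMap.toContinuousLinearMap
      (QkW L m n φ (fun _ : Bond d (towerP L m (n + 1)) => (1 : 𝔸ˣ)) hL (fun _ => 0) (fun _ => by norm_num)
        (perCfg_UlevOf_one_mem_U1 L m (n + 1)) (norm_Wcx_UlevOf_one_sub_one_le L m (n + 1) (fun _ => 0) (fun _ => le_rfl))
        (c₀ := c₀) (c₁ := c₁))).le_opNorm x
  -- the lattice constants
  have hnc : 0 ≤ ‖((η : ℂ))⁻¹‖ := norm_nonneg _
  obtain ⟨KR, hKRdef⟩ : ∃ KR : ℝ, KR = 2 * Mφ * Mφ' := ⟨_, rfl⟩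
  have hKR : 0 ≤ KR := by rw [hKRdef]; positivity
  obtain ⟨B, hBdef⟩ : ∃ B : ℝ, B = μ * CS + 6 * ‖((η : ℂ))⁻¹‖ ^ 2 * d * KR + 16 * ‖((η : ℂ))⁻¹‖ ^ 2 * d * CS := ⟨_, rfl⟩
  have hB : 0 ≤ B := by rw [hBdef]; positivity
  obtain ⟨K, hKdef⟩ : ∃ K : ℝ, K = 48 * d * ‖((η : ℂ))⁻¹‖ ^ 2 * KR + 8 * ‖((η : ℂ))⁻¹‖ ^ 2 * d * KR + 64 * ‖((η : ℂ))⁻¹‖ ^ 2 * d * (6 * ‖((η : ℂ))⁻¹‖ ^ 2 * d * KR + 16 * ‖((η : ℂ))⁻¹‖ ^ 2 * d * CS) / μ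
    + |a| * (2 * MQ + 1) := ⟨_, rfl⟩
  have hK : 0 ≤ K := by rw [hKdef]; positivity
  refine ⟨γ₀ / 2, min (1 / (KR + 1)) (min (μ / (2 * B + 1)) (γ₀ / (2 * K + 1))), by positivity, by positivity, ?_⟩
  intro U hU1 hreg S₁ S₂ ε ρ' δQ hε hρ' hδQ ht hUb hUε hRS hS₁ hS₂ hρ₁' hρ₂' hQ x
  -- `t = ε + ρ′ + δ_Q` and its three consequences
  have ht1 : ε + ρ' + δQ ≤ 1 / (KR + 1) := ht.trans (min_le_left _ _)
  have ht2 : ε + ρ' + δQ ≤ μ / (2 * B + 1) := ht.trans ((min_le_right _ _).trans (min_le_left _ _))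
  have ht3 : ε + ρ' + δQ ≤ γ₀ / (2 * K + 1) := ht.trans ((min_le_right _ _).trans (min_le_right _ _))
  have hεt : ε ≤ ε + ρ' + δQ := by linarith
  have hρt : ρ' ≤ ε + ρ' + δQ := by linarith
  have hδQt : δQ ≤ ε + ρ' + δQ := by linarith
  have ht01 : ε + ρ' + δQ ≤ 1 := ht1.trans (by rw [div_le_one (by positivity)]; linarith)
  have hδQ1 : δQ ≤ 1 := hδQt.trans ht01
  -- the letters of §2
  obtain ⟨εR, hεRdef⟩ : ∃ εR : ℝ, εR = KR * ε := ⟨_, rfl⟩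
  have hεR : 0 ≤ εR := by rw [hεRdef]; positivity
  have hεRt : εR ≤ KR * (ε + ρ' + δQ) := by rw [hεRdef]; exact mul_le_mul_of_nonneg_left hεt hKR
  have hεR1 : εR ≤ 1 := by
    refine hεRt.trans ((mul_le_mul_of_nonneg_left ht1 hKR).trans ?_)
    rw [mul_one_div, div_le_one (by positivity)]; linarith
  have hR : ∀ (b : Bond d (towerP L m (n + 1))) (w : W), ‖adTransportW φ U b w - w‖ ≤ εR * ‖w‖ := fun b w => by
    have h := norm_adTransportW_sub_le φ hφ hφ' hMφ' U b (hUb b) (hUε b) w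
    rw [hεRdef, hKRdef]; linarith
  obtain ⟨ρ, hρdef⟩ : ∃ ρ : ℝ, ρ = CS * ρ' := ⟨_, rfl⟩
  have hρ0 : 0 ≤ ρ := by rw [hρdef]; positivity
  have hρ₂ : ∀ l : SiteL2K ℂ d (towerP L m (n + 1)) c₀ W,
      ‖S₂ (QprimeTowerW L m n φ U l - QprimeTowerW L m n φ (fun _ : Bond d (towerP L m (n + 1)) => (1 : 𝔸ˣ)) l)‖ ≤ ρ * ‖l‖ := fun l =>
    (hρ₂' l).trans (by rw [hρdef, hCSdef, one_mul])
  have hρ₁ : ∀ l : SiteL2K ℂ d (towerP L m (n + 1)) c₀ W,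
      ‖S₁ (QprimeTowerW L m n φ (fun _ : Bond d (towerP L m (n + 1)) => (1 : 𝔸ˣ)) l - QprimeTowerW L m n φ U l)‖ ≤ ρ * ‖l‖ := fun l =>
    (hρ₁' l).trans (by rw [hρdef, hCSdef, one_mul])
  have hρt : ρ ≤ CS * (ε + ρ' + δQ) := by rw [hρdef]; exact mul_le_mul_of_nonneg_left hρt hCS
  -- the smallness bookkeeping: `εΔ + Mρ + μρ ≤ B·t ≤ μ/2`
  have hd0 : (0 : ℝ) ≤ d := Nat.cast_nonneg d
  have hsd : Real.sqrt d * Real.sqrt d = d := Real.mul_self_sqrt hd0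
  have hεΔ : 2 * (2 + εR) * ‖((η : ℂ))⁻¹‖ ^ 2 * d * εR ≤ 6 * ‖((η : ℂ))⁻¹‖ ^ 2 * d * KR * (ε + ρ' + δQ) := by
    have h1 : 2 * (2 + εR) ≤ 6 := by linarith
    calc 2 * (2 + εR) * ‖((η : ℂ))⁻¹‖ ^ 2 * d * εR = (2 * (2 + εR)) * (‖((η : ℂ))⁻¹‖ ^ 2 * d * εR) := by ring
      _ ≤ 6 * (‖((η : ℂ))⁻¹‖ ^ 2 * d * (KR * (ε + ρ' + δQ))) :=
          mul_le_mul h1 (mul_le_mul_of_nonneg_left hεRt (by positivity)) (by positivity) (by norm_num)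
      _ = 6 * ‖((η : ℂ))⁻¹‖ ^ 2 * d * KR * (ε + ρ' + δQ) := by ring
  have hM16 : 4 * (1 + εR) ^ 2 * ‖((η : ℂ))⁻¹‖ ^ 2 * d ≤ 16 * ‖((η : ℂ))⁻¹‖ ^ 2 * d := by
    have h1 : (1 + εR) ^ 2 ≤ 4 := by
      calc (1 + εR) ^ 2 ≤ 2 ^ 2 := pow_le_pow_left₀ (by positivity) (by linarith) 2
        _ = 4 := by norm_num
    calc 4 * (1 + εR) ^ 2 * ‖((η : ℂ))⁻¹‖ ^ 2 * d = (1 + εR) ^ 2 * (4 * ‖((η : ℂ))⁻¹‖ ^ 2 * d) := by ring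
      _ ≤ 4 * (4 * ‖((η : ℂ))⁻¹‖ ^ 2 * d) := mul_le_mul_of_nonneg_right h1 (by positivity)
      _ = 16 * ‖((η : ℂ))⁻¹‖ ^ 2 * d := by ring
  have hMρ : 4 * (1 + εR) ^ 2 * ‖((η : ℂ))⁻¹‖ ^ 2 * d * ρ ≤ 16 * ‖((η : ℂ))⁻¹‖ ^ 2 * d * CS * (ε + ρ' + δQ) :=
    calc 4 * (1 + εR) ^ 2 * ‖((η : ℂ))⁻¹‖ ^ 2 * d * ρ ≤ 16 * ‖((η : ℂ))⁻¹‖ ^ 2 * d * ρ := mul_le_mul_of_nonneg_right hM16 hρ0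
      _ ≤ 16 * ‖((η : ℂ))⁻¹‖ ^ 2 * d * (CS * (ε + ρ' + δQ)) := mul_le_mul_of_nonneg_left hρt (by positivity)
      _ = 16 * ‖((η : ℂ))⁻¹‖ ^ 2 * d * CS * (ε + ρ' + δQ) := by ring
  have hμρ : μ * ρ ≤ μ * CS * (ε + ρ' + δQ) := by
    rw [mul_assoc]; exact mul_le_mul_of_nonneg_left hρt hμ.le
  have hBt : B * (ε + ρ' + δQ) ≤ μ / 2 := mul_le_half_of_le_div hB hμ.le ht2
  have hsum : μ * ρ + (2 * (2 + εR) * ‖((η : ℂ))⁻¹‖ ^ 2 * d * εR + 4 * (1 + εR) ^ 2 * ‖((η : ℂ))⁻¹‖ ^ 2 * d * ρ) ≤ μ / 2 := by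
    have : μ * CS * (ε + ρ' + δQ) + (6 * ‖((η : ℂ))⁻¹‖ ^ 2 * d * KR * (ε + ρ' + δQ) + 16 * ‖((η : ℂ))⁻¹‖ ^ 2 * d * CS * (ε + ρ' + δQ)) = B * (ε + ρ' + δQ) := by
      rw [hBdef]; ring
    linarith [hμρ, hεΔ, hMρ]
  have hrew : μ * (1 - ρ) - (2 * (2 + εR) * ‖((η : ℂ))⁻¹‖ ^ 2 * d * εR + 4 * (1 + εR) ^ 2 * ‖((η : ℂ))⁻¹‖ ^ 2 * d * ρ) =
      μ - (μ * ρ + (2 * (2 + εR) * ‖((η : ℂ))⁻¹‖ ^ 2 * d * εR + 4 * (1 + εR) ^ 2 * ‖((η : ℂ))⁻¹‖ ^ 2 * d * ρ)) := by ring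
  have hν2 : μ / 2 ≤ μ * (1 - ρ) - (2 * (2 + εR) * ‖((η : ℂ))⁻¹‖ ^ 2 * d * εR + 4 * (1 + εR) ^ 2 * ‖((η : ℂ))⁻¹‖ ^ 2 * d * ρ) := by
    rw [hrew]; linarith
  have hν : 0 < μ * (1 - ρ) - (2 * (2 + εR) * ‖((η : ℂ))⁻¹‖ ^ 2 * d * εR + 4 * (1 + εR) ^ 2 * ‖((η : ℂ))⁻¹‖ ^ 2 * d * ρ) :=
    lt_of_lt_of_le (by positivity) hν2
  -- the `R`-remainder: `δR ≤ 4(εΔ + Mρ)/μ ≤ 4(6nc²dK_R + 16nc²dC_S)t/μ`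
  have hδR : 2 * (2 * (2 + εR) * ‖((η : ℂ))⁻¹‖ ^ 2 * d * εR + 4 * (1 + εR) ^ 2 * ‖((η : ℂ))⁻¹‖ ^ 2 * d * ρ) /
      (μ * (1 - ρ) - (2 * (2 + εR) * ‖((η : ℂ))⁻¹‖ ^ 2 * d * εR + 4 * (1 + εR) ^ 2 * ‖((η : ℂ))⁻¹‖ ^ 2 * d * ρ)) ≤
      4 * (6 * ‖((η : ℂ))⁻¹‖ ^ 2 * d * KR + 16 * ‖((η : ℂ))⁻¹‖ ^ 2 * d * CS) * (ε + ρ' + δQ) / μ := by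
    have hnum : 0 ≤ 2 * (2 * (2 + εR) * ‖((η : ℂ))⁻¹‖ ^ 2 * d * εR + 4 * (1 + εR) ^ 2 * ‖((η : ℂ))⁻¹‖ ^ 2 * d * ρ) := by positivity
    calc _ ≤ 2 * (2 * (2 + εR) * ‖((η : ℂ))⁻¹‖ ^ 2 * d * εR + 4 * (1 + εR) ^ 2 * ‖((η : ℂ))⁻¹‖ ^ 2 * d * ρ) / (μ / 2) :=
          div_le_div_of_nonneg_left hnum (by positivity) hν2
      _ = 4 * (2 * (2 + εR) * ‖((η : ℂ))⁻¹‖ ^ 2 * d * εR + 4 * (1 + εR) ^ 2 * ‖((η : ℂ))⁻¹‖ ^ 2 * d * ρ) / μ := by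
          field_simp; ring
      _ ≤ 4 * (6 * ‖((η : ℂ))⁻¹‖ ^ 2 * d * KR * (ε + ρ' + δQ) + 16 * ‖((η : ℂ))⁻¹‖ ^ 2 * d * CS * (ε + ρ' + δQ)) / μ := by
          gcongr
      _ = 4 * (6 * ‖((η : ℂ))⁻¹‖ ^ 2 * d * KR + 16 * ‖((η : ℂ))⁻¹‖ ^ 2 * d * CS) * (ε + ρ' + δQ) / μ := by ring
  -- the four pieces of the remainder constant against `K·t`
  have hP' : 16 * d * (2 + εR) * ‖((η : ℂ))⁻¹‖ ^ 2 * εR ≤ 48 * d * ‖((η : ℂ))⁻¹‖ ^ 2 * KR * (ε + ρ' + δQ) := by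
    have h1 : 2 + εR ≤ 3 := by linarith
    calc 16 * d * (2 + εR) * ‖((η : ℂ))⁻¹‖ ^ 2 * εR = (16 * d * ‖((η : ℂ))⁻¹‖ ^ 2) * ((2 + εR) * εR) := by ring
      _ ≤ (16 * d * ‖((η : ℂ))⁻¹‖ ^ 2) * (3 * (KR * (ε + ρ' + δQ))) :=
          mul_le_mul_of_nonneg_left (mul_le_mul h1 hεRt hεR (by norm_num)) (by positivity)
      _ = 48 * d * ‖((η : ℂ))⁻¹‖ ^ 2 * KR * (ε + ρ' + δQ) := by ring
  have hD' : 2 * (2 * (1 + εR) * ‖((η : ℂ))⁻¹‖ * Real.sqrt d) * (‖((η : ℂ))⁻¹‖ * εR * Real.sqrt d) ≤ 8 * ‖((η : ℂ))⁻¹‖ ^ 2 * d * KR * (ε + ρ' + δQ) := by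
    have h1 : 1 + εR ≤ 2 := by linarith
    calc 2 * (2 * (1 + εR) * ‖((η : ℂ))⁻¹‖ * Real.sqrt d) * (‖((η : ℂ))⁻¹‖ * εR * Real.sqrt d) = 4 * ‖((η : ℂ))⁻¹‖ ^ 2 * (Real.sqrt d * Real.sqrt d) * ((1 + εR) * εR) := by ring
      _ = 4 * ‖((η : ℂ))⁻¹‖ ^ 2 * d * ((1 + εR) * εR) := by rw [hsd]
      _ ≤ 4 * ‖((η : ℂ))⁻¹‖ ^ 2 * d * (2 * (KR * (ε + ρ' + δQ))) :=
          mul_le_mul_of_nonneg_left (mul_le_mul h1 hεRt hεR (by norm_num)) (by positivity)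
      _ = 8 * ‖((η : ℂ))⁻¹‖ ^ 2 * d * KR * (ε + ρ' + δQ) := by ring
  have hR' : (2 * (1 + εR) * ‖((η : ℂ))⁻¹‖ * Real.sqrt d) ^ 2 *
      (2 * (2 * (2 + εR) * ‖((η : ℂ))⁻¹‖ ^ 2 * d * εR + 4 * (1 + εR) ^ 2 * ‖((η : ℂ))⁻¹‖ ^ 2 * d * ρ) /
        (μ * (1 - ρ) - (2 * (2 + εR) * ‖((η : ℂ))⁻¹‖ ^ 2 * d * εR + 4 * (1 + εR) ^ 2 * ‖((η : ℂ))⁻¹‖ ^ 2 * d * ρ))) ≤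
      64 * ‖((η : ℂ))⁻¹‖ ^ 2 * d * (6 * ‖((η : ℂ))⁻¹‖ ^ 2 * d * KR + 16 * ‖((η : ℂ))⁻¹‖ ^ 2 * d * CS) / μ * (ε + ρ' + δQ) := by
    have hsq : (2 * (1 + εR) * ‖((η : ℂ))⁻¹‖ * Real.sqrt d) ^ 2 = 4 * (1 + εR) ^ 2 * ‖((η : ℂ))⁻¹‖ ^ 2 * d := by
      rw [show (2 * (1 + εR) * ‖((η : ℂ))⁻¹‖ * Real.sqrt d) ^ 2 = 4 * (1 + εR) ^ 2 * ‖((η : ℂ))⁻¹‖ ^ 2 * (Real.sqrt d * Real.sqrt d) by ring, hsd]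
    rw [hsq]
    have hδR0 : 0 ≤ 2 * (2 * (2 + εR) * ‖((η : ℂ))⁻¹‖ ^ 2 * d * εR + 4 * (1 + εR) ^ 2 * ‖((η : ℂ))⁻¹‖ ^ 2 * d * ρ) /
        (μ * (1 - ρ) - (2 * (2 + εR) * ‖((η : ℂ))⁻¹‖ ^ 2 * d * εR + 4 * (1 + εR) ^ 2 * ‖((η : ℂ))⁻¹‖ ^ 2 * d * ρ)) := div_nonneg (by positivity) hν.le
    calc 4 * (1 + εR) ^ 2 * ‖((η : ℂ))⁻¹‖ ^ 2 * d * (2 * (2 * (2 + εR) * ‖((η : ℂ))⁻¹‖ ^ 2 * d * εR + 4 * (1 + εR) ^ 2 * ‖((η : ℂ))⁻¹‖ ^ 2 * d * ρ) /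
          (μ * (1 - ρ) - (2 * (2 + εR) * ‖((η : ℂ))⁻¹‖ ^ 2 * d * εR + 4 * (1 + εR) ^ 2 * ‖((η : ℂ))⁻¹‖ ^ 2 * d * ρ)))
        ≤ 16 * ‖((η : ℂ))⁻¹‖ ^ 2 * d * (4 * (6 * ‖((η : ℂ))⁻¹‖ ^ 2 * d * KR + 16 * ‖((η : ℂ))⁻¹‖ ^ 2 * d * CS) * (ε + ρ' + δQ) / μ) :=
          mul_le_mul hM16 hδR hδR0 (by positivity)
      _ = 64 * ‖((η : ℂ))⁻¹‖ ^ 2 * d * (6 * ‖((η : ℂ))⁻¹‖ ^ 2 * d * KR + 16 * ‖((η : ℂ))⁻¹‖ ^ 2 * d * CS) / μ * (ε + ρ' + δQ) := by ring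
  have hQ'' : |a| * δQ * (2 * MQ + δQ) ≤ |a| * (2 * MQ + 1) * (ε + ρ' + δQ) := by
    have h1 : 2 * MQ + δQ ≤ 2 * MQ + 1 := by linarith
    calc |a| * δQ * (2 * MQ + δQ) = |a| * (δQ * (2 * MQ + δQ)) := by ring
      _ ≤ |a| * ((ε + ρ' + δQ) * (2 * MQ + 1)) :=
          mul_le_mul_of_nonneg_left (mul_le_mul hδQt h1 (by positivity) (by positivity)) (abs_nonneg a)
      _ = |a| * (2 * MQ + 1) * (ε + ρ' + δQ) := by ring
  have hKt : K * (ε + ρ' + δQ) ≤ γ₀ / 2 := mul_le_half_of_le_div hK hγ₀.le ht3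
  have hδ : 16 * d * (2 + εR) * ‖((η : ℂ))⁻¹‖ ^ 2 * εR
      + 2 * (2 * (1 + εR) * ‖((η : ℂ))⁻¹‖ * Real.sqrt d) * (‖((η : ℂ))⁻¹‖ * εR * Real.sqrt d)
      + (2 * (1 + εR) * ‖((η : ℂ))⁻¹‖ * Real.sqrt d) ^ 2 *
        (2 * (2 * (2 + εR) * ‖((η : ℂ))⁻¹‖ ^ 2 * d * εR + 4 * (1 + εR) ^ 2 * ‖((η : ℂ))⁻¹‖ ^ 2 * d * ρ) /
          (μ * (1 - ρ) - (2 * (2 + εR) * ‖((η : ℂ))⁻¹‖ ^ 2 * d * εR + 4 * (1 + εR) ^ 2 * ‖((η : ℂ))⁻¹‖ ^ 2 * d * ρ)))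
      + |a| * δQ * (2 * MQ + δQ) ≤ γ₀ / 2 := by
    have hKsum : 48 * d * ‖((η : ℂ))⁻¹‖ ^ 2 * KR * (ε + ρ' + δQ) + 8 * ‖((η : ℂ))⁻¹‖ ^ 2 * d * KR * (ε + ρ' + δQ)
        + 64 * ‖((η : ℂ))⁻¹‖ ^ 2 * d * (6 * ‖((η : ℂ))⁻¹‖ ^ 2 * d * KR + 16 * ‖((η : ℂ))⁻¹‖ ^ 2 * d * CS) / μ * (ε + ρ' + δQ) + |a| * (2 * MQ + 1) * (ε + ρ' + δQ)
        = K * (ε + ρ' + δQ) := by rw [hKdef]; ring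
    calc _ ≤ 48 * d * ‖((η : ℂ))⁻¹‖ ^ 2 * KR * (ε + ρ' + δQ) + 8 * ‖((η : ℂ))⁻¹‖ ^ 2 * d * KR * (ε + ρ' + δQ)
        + 64 * ‖((η : ℂ))⁻¹‖ ^ 2 * d * (6 * ‖((η : ℂ))⁻¹‖ ^ 2 * d * KR + 16 * ‖((η : ℂ))⁻¹‖ ^ 2 * d * CS) / μ * (ε + ρ' + δQ)
        + |a| * (2 * MQ + 1) * (ε + ρ' + δQ) := add_le_add (add_le_add (add_le_add hP' hD') hR') hQ''
      _ = K * (ε + ρ' + δQ) := hKsum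
      _ ≤ γ₀ / 2 := hKt
  -- conclusion: `γ₀ − γ₀/2 = γ₀/2`
  have h := coercive_of_sub_le (δ := γ₀ / 2) hflat (fun y =>
    (norm_principalGFk_sub_flat_le L m n hL φ η a U α hα1 hU1 hreg hεR hρ0 hδQ hMQ hμ hR hRS hmod S₁ S₂ hS₁ hS₂ hρ₁ hρ₂ hQ hQ₁ hν y).trans
      (mul_le_mul_of_nonneg_right hδ (norm_nonneg _))) x
  have h2 : γ₀ / 2 = γ₀ - γ₀ / 2 := by ring
  rw [h2]
  exact h

end SmallField

/-! ## §2 [B9] Thm 3.11 for the `k`-level operator `Δ_a(U)` (with the curvature part) at every small field, `L²` sections -/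

section Hpos

open B9Eq310DeltaPrime (plaqHolU)
open B9Eq315QTorusOnto (liftSite perSite_liftSite)
open B9Eq326OperatorTower (laplaceAk)
open B9Ineq369CurvatureSmall (hpos_of_smallCurvature)
open B9Thm311SmallFieldClosed (norm_plaqHolU_sub_one_le hRS_of_unitary)

variable [StarRing 𝔸] [NormedStarGroup 𝔸] [StarModule ℂ 𝔸] (α : ℕ → ℝ) (hα1 : ∀ j, α j ≤ 1 / 64)

/-- **[B9] THM 3.11 «Δ_a IS POSITIVE DEFINITE» FOR THE `k`-LEVEL OPERATOR `laplaceAk` AT EVERY SMALL FIELD OF A FIXED LATTICE, the sections of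
`Q′_k` read in `L²`**: there is `ε₀ > 0` (a finite-lattice number) such that for EVERY background `U` of the tower's data with `U(b) ∈ U1`,
`‖U(b) − 1‖ ≤ ε`, `hRS`, right inverses `S₁`∕`S₂` of `Q′_k(1)`∕`Q′_k(U)` with the two `L²` letters of §1, `‖Q_k(U)x − Q_k(1)x‖ ≤ δ_Q‖x‖` and
`ε + ρ + δ_Q ≤ ε₀`, the DISPLAYED `hpos` of `B9Eq326OperatorTower.G1k ∕ H1k ∕ frakGk` HOLDS: `0 < re⟨x, Δ_a^{(k)}(U)x⟩` for `x ≠ 0` — §1 + the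
fine-lattice curvature part (`hpos_of_smallCurvature`), the host's §4 proof verbatim.  NOT print's uniform statement.
[cite: Balaban1985BackgroundPropagators, Thm 3.11 p.416, (3.69) p.404, (3.82)–(3.86) p.407, (3.26) p.395] -/
theorem laplaceAk_pos_of_small_field_L2 {η : ℝ} (hη : η ≠ 0) {a : ℝ} (ha : 0 < a) {Mφ Mφ' : ℝ} (hMφ : 0 ≤ Mφ) (hMφ' : 0 ≤ Mφ')
    (hφ : ∀ w, ‖φ w‖ ≤ Mφ * ‖w‖) (hφ' : ∀ X, ‖φ.symm X‖ ≤ Mφ' * ‖X‖) (τ : 𝔸 →ₗ[ℂ] ℂ) {Cτ : ℝ} (hτ : ∀ X, ‖τ X‖ ≤ Cτ * ‖X‖) (hCτ : 0 ≤ Cτ) :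
    ∃ ε₀ : ℝ, 0 < ε₀ ∧ ∀ (U : Bond d (towerP L m (n + 1)) → 𝔸ˣ)
      (hU1 : ∀ (j : ℕ) (x : B7Prop1Explicit.Site d) (κ : Fin d), perCfg (towerP L m (j + 1)) (UlevOf L m (n + 1) U j) x κ ∈ U1 𝔸)
      (hreg : ∀ (j : ℕ) (y : TSite d (towerP L m j)) (κ : Fin d) (r : Fin d → Fin L),
        ‖((Wcx L (perCfg (towerP L m (j + 1)) (UlevOf L m (n + 1) U j)) (cornerSite L y) κ (boxVec L r) : 𝔸ˣ) : 𝔸) - 1‖ ≤ α j)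
      (S₁ S₂ : (TSite d m → W) →ₗ[ℂ] SiteL2K ℂ d (towerP L m (n + 1)) c₀ W)
      {ε ρ' δQ : ℝ}, 0 ≤ ε → 0 ≤ ρ' → 0 ≤ δQ → ε + ρ' + δQ ≤ ε₀ →
      (∀ b, U b ∈ U1 𝔸) → (∀ b, ‖(U b : 𝔸) - 1‖ ≤ ε) →
      (∀ (b : Bond d (towerP L m (n + 1))) (v u : W), ⟪adTransportW φ U b v, u⟫_ℂ = ⟪v, adTransportW φ (fun b => (U b)⁻¹) b u⟫_ℂ) →
      (∀ f, QprimeTowerW L m n φ (fun _ : Bond d (towerP L m (n + 1)) => (1 : 𝔸ˣ)) (S₁ f) = f) →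
      (∀ f, QprimeTowerW L m n φ U (S₂ f) = f) →
      (∀ l : SiteL2K ℂ d (towerP L m (n + 1)) c₀ W,
        ‖S₁ (QprimeTowerW L m n φ (fun _ : Bond d (towerP L m (n + 1)) => (1 : 𝔸ˣ)) l - QprimeTowerW L m n φ U l)‖ ≤ ρ' * ‖l‖) →
      (∀ l : SiteL2K ℂ d (towerP L m (n + 1)) c₀ W,
        ‖S₂ (QprimeTowerW L m n φ U l - QprimeTowerW L m n φ (fun _ : Bond d (towerP L m (n + 1)) => (1 : 𝔸ˣ)) l)‖ ≤ ρ' * ‖l‖) →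
      (∀ x : BondL2K ℂ d (towerP L m (n + 1)) c₀ W, ‖QkW L m n φ U hL α hα1 hU1 hreg (c₁ := c₁) x -
        QkW L m n φ (fun _ : Bond d (towerP L m (n + 1)) => (1 : 𝔸ˣ)) hL (fun _ => 0) (fun _ => by norm_num)
          (perCfg_UlevOf_one_mem_U1 L m (n + 1)) (norm_Wcx_UlevOf_one_sub_one_le L m (n + 1) (fun _ => 0) (fun _ => le_rfl)) (c₁ := c₁) x‖ ≤
        δQ * ‖x‖) →
      ∀ x : BondL2K ℂ d (towerP L m (n + 1)) c₀ W, x ≠ 0 →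
        0 < RCLike.re ⟪x, laplaceAk L m n φ η U hL α hα1 hU1 hreg τ (c₀ := c₀) (c₁ := c₁) a x⟫_ℂ := by
  have hc₀ : 0 < c₀ := Fact.out
  obtain ⟨γ, ε₁, hγ, hε₁, H⟩ := exists_coercive_principalk_of_small_field_L2 L m n hL φ (c₀ := c₀) (c₁ := c₁) α hα1 hη ha hMφ hMφ' hφ hφ'
  obtain ⟨Kc, hKcdef⟩ : ∃ Kc : ℝ, Kc = 32 * d * Cτ * Mφ ^ 2 * (|η| ^ d / c₀) * (‖((η : ℂ))⁻¹‖ ^ 2 * 4) := ⟨_, rfl⟩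
  have hKc : 0 ≤ Kc := by rw [hKcdef]; positivity
  refine ⟨min ε₁ (γ / (Kc + 1) / 2), by positivity, ?_⟩
  intro U hU1 hreg S₁ S₂ ε ρ' δQ hε hρ' hδQ ht hUb hUε hRS hS₁ hS₂ hρ₁ hρ₂ hQ x hx
  have hUb' : ∀ b : Bond d (towerP L m (n + 1)), ‖(U b : 𝔸)‖ ≤ 1 ∧ ‖(((U b)⁻¹ : 𝔸ˣ) : 𝔸)‖ ≤ 1 := fun b => B7Prop1Explicit.mem_U1.1 (hUb b)
  have hpl : ∀ p : B9SectCLatticeCarrier.Plaq d (towerP L m (n + 1)), ‖(plaqHolU U p : 𝔸) - 1‖ ≤ 4 * ε := norm_plaqHolU_sub_one_le hUb hUε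
  have hγU := H U hU1 hreg S₁ S₂ hε hρ' hδQ (ht.trans (min_le_left _ _)) hUb hUε hRS hS₁ hS₂ hρ₁ hρ₂ hQ
  -- the curvature constant `Kc·ε < γ`
  have hεt : ε ≤ γ / (Kc + 1) / 2 := by
    have : ε ≤ ε + ρ' + δQ := by linarith
    exact this.trans (ht.trans (min_le_right _ _))
  have hsmall : 32 * d * Cτ * Mφ ^ 2 * (|η| ^ d / c₀) * (‖((η : ℂ))⁻¹‖ ^ 2 * (4 * ε)) < γ := by
    have h1 : 32 * d * Cτ * Mφ ^ 2 * (|η| ^ d / c₀) * (‖((η : ℂ))⁻¹‖ ^ 2 * (4 * ε)) = Kc * ε := by rw [hKcdef]; ring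
    rw [h1]
    have h3 : Kc * ε ≤ Kc * (γ / (Kc + 1) / 2) := mul_le_mul_of_nonneg_left hεt hKc
    have h4 : Kc * (γ / (Kc + 1) / 2) < γ := by
      rw [mul_div_assoc', mul_div_assoc', div_div, div_lt_iff₀ (by positivity)]
      nlinarith
    exact h3.trans_lt h4
  rw [laplaceAk]
  exact hpos_of_smallCurvature φ hτ hCτ hφ η hUb' hpl (by positivity) _ _ _ _ _ a hγU hsmall x hx

/-- **THE SAME WITH `hRS` DISCHARGED BY THE MODEL LETTERS** (`B9Thm311SmallFieldClosed.hRS_of_unitary`): unitary bond variables, a tracial `τ`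
norming the fibre. [cite: Balaban1985BackgroundPropagators, Thm 3.11 p.416, (3.5) p.391; Balaban1985Averaging, (17)–(18) pp.20–21] -/
theorem laplaceAk_pos_of_small_field_unitary_L2 {η : ℝ} (hη : η ≠ 0) {a : ℝ} (ha : 0 < a) {Mφ Mφ' : ℝ} (hMφ : 0 ≤ Mφ) (hMφ' : 0 ≤ Mφ')
    (hφ : ∀ w, ‖φ w‖ ≤ Mφ * ‖w‖) (hφ' : ∀ X, ‖φ.symm X‖ ≤ Mφ' * ‖X‖) (τ : 𝔸 →ₗ[ℂ] ℂ) {Cτ : ℝ} (hτ : ∀ X, ‖τ X‖ ≤ Cτ * ‖X‖) (hCτ : 0 ≤ Cτ)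
    (hτφ : ∀ X Y : 𝔸, ⟪φ.symm X, φ.symm Y⟫_ℂ = τ (star X * Y)) (htr : ∀ X Y : 𝔸, τ (X * Y) = τ (Y * X)) :
    ∃ ε₀ : ℝ, 0 < ε₀ ∧ ∀ (U : Bond d (towerP L m (n + 1)) → 𝔸ˣ)
      (hU1 : ∀ (j : ℕ) (x : B7Prop1Explicit.Site d) (κ : Fin d), perCfg (towerP L m (j + 1)) (UlevOf L m (n + 1) U j) x κ ∈ U1 𝔸)
      (hreg : ∀ (j : ℕ) (y : TSite d (towerP L m j)) (κ : Fin d) (r : Fin d → Fin L),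
        ‖((Wcx L (perCfg (towerP L m (j + 1)) (UlevOf L m (n + 1) U j)) (cornerSite L y) κ (boxVec L r) : 𝔸ˣ) : 𝔸) - 1‖ ≤ α j)
      (S₁ S₂ : (TSite d m → W) →ₗ[ℂ] SiteL2K ℂ d (towerP L m (n + 1)) c₀ W)
      {ε ρ' δQ : ℝ}, 0 ≤ ε → 0 ≤ ρ' → 0 ≤ δQ → ε + ρ' + δQ ≤ ε₀ →
      (∀ b, U b ∈ U1 𝔸) → (∀ b, ‖(U b : 𝔸) - 1‖ ≤ ε) → (∀ b, star (U b : 𝔸) = (((U b)⁻¹ : 𝔸ˣ) : 𝔸)) →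
      (∀ f, QprimeTowerW L m n φ (fun _ : Bond d (towerP L m (n + 1)) => (1 : 𝔸ˣ)) (S₁ f) = f) →
      (∀ f, QprimeTowerW L m n φ U (S₂ f) = f) →
      (∀ l : SiteL2K ℂ d (towerP L m (n + 1)) c₀ W,
        ‖S₁ (QprimeTowerW L m n φ (fun _ : Bond d (towerP L m (n + 1)) => (1 : 𝔸ˣ)) l - QprimeTowerW L m n φ U l)‖ ≤ ρ' * ‖l‖) →
      (∀ l : SiteL2K ℂ d (towerP L m (n + 1)) c₀ W,
        ‖S₂ (QprimeTowerW L m n φ U l - QprimeTowerW L m n φ (fun _ : Bond d (towerP L m (n + 1)) => (1 : 𝔸ˣ)) l)‖ ≤ ρ' * ‖l‖) →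
      (∀ x : BondL2K ℂ d (towerP L m (n + 1)) c₀ W, ‖QkW L m n φ U hL α hα1 hU1 hreg (c₁ := c₁) x -
        QkW L m n φ (fun _ : Bond d (towerP L m (n + 1)) => (1 : 𝔸ˣ)) hL (fun _ => 0) (fun _ => by norm_num)
          (perCfg_UlevOf_one_mem_U1 L m (n + 1)) (norm_Wcx_UlevOf_one_sub_one_le L m (n + 1) (fun _ => 0) (fun _ => le_rfl)) (c₁ := c₁) x‖ ≤
        δQ * ‖x‖) →
      ∀ x : BondL2K ℂ d (towerP L m (n + 1)) c₀ W, x ≠ 0 →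
        0 < RCLike.re ⟪x, laplaceAk L m n φ η U hL α hα1 hU1 hreg τ (c₀ := c₀) (c₁ := c₁) a x⟫_ℂ := by
  obtain ⟨ε₀, hε₀, H⟩ := laplaceAk_pos_of_small_field_L2 L m n hL φ (c₀ := c₀) (c₁ := c₁) α hα1 hη ha hMφ hMφ' hφ hφ' τ hτ hCτ
  exact ⟨ε₀, hε₀, fun U hU1 hreg S₁ S₂ ε ρ' δQ hε hρ' hδQ ht hUb hUε hUstar hS₁ hS₂ hρ₁ hρ₂ hQ x hx =>
    H U hU1 hreg S₁ S₂ hε hρ' hδQ ht hUb hUε (hRS_of_unitary φ τ hτφ htr U hUstar) hS₁ hS₂ hρ₁ hρ₂ hQ x hx⟩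

end Hpos

end Literature.MathematicalPhysics.QuantumFieldTheory.Balaban1983to89.B9Thm311SmallFieldCoercivityTowerL2

end
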